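import Summits.HodgeConjecture.CorCM.Census.TwistTwoColumnPrep

/-!
# Uniform twist generation, XVII: TWO COLUMNS — the double corner of a transfer face lies in the UPPER class, the transfer faces yield the
# transfers, and the `n` residual blocks

COR-CM (cell `pub-hodgecm2`), count-neutral kernel combinatorics by the binder seat b09 (gen 37; lane UNIFORM TWIST GENERATION, part XVII), on
parts I–XVI used BY NAME.  Theorems only: no definition, no `decide`, no certificate, no named fact, no `sorry`.
HONEST FRAMING: `HC_CM` is NOT proved, here or anywhere in the tree; nothing here is a period or a headline.

Along a datum `θ : G ≃ ℤ/2n × B` with `B = {b₁, b₂}` (`|B| = 2`, `n ≥ 2`):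
* §1 the double corner `Y_k = (catom 0 b₂)^{(θ⁻¹(k, b₁))}` of the transfer face `gface (cst 0) θ⁻¹(k, b₁) θ⁻¹(0, b₂)` (`2 ≤ k < n`) lies in the
  UPPER class `upCl 1` (part X) — nearest centres `{0, 1}`, and `{−1, 0, 1}` when `k = n − 1`, so part IVʼs near class does NOT suffice (exact
  centre distances of part XVI and two flip laws, `corner_mem_upCl_one`) — and its star form about `cst 1` is `[catom 0 b₂] + [cst 1^{(θ⁻¹(k,b₁))}]
  − [cst 1]` by the two-column coincidence (`thetaG_cst_one_corner`);
* §2 hence the transfer face yields `trans 0 k b₁` whenever `L` holds the star forms of the upper classes (`trans_zero_mem_two`);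
* §3 the count: the centre block and the atom blocks of the rows `1, …, n − 1` are `n` DISTINCT residual blocks (with two columns the rows `0` and
  `n − 1` would coincide; `eq_of_blk_oflipCM_eq_two` via the distance `3` from `cst 1`), so the blocks of potential `≥ 2` number at most `β − n`
  (`card_filter_add_le_card_block_two`).
Part XVIII (`Census/TwistTwoColumnLaw.lean`) assembles the two-column law `μ = β − 1`.

## References
* [Pohlmann1968] H. Pohlmann, Algebraic cycles on abelian varieties of complex multiplication type, Ann. of Math. 88 (1968), Thm 1.
* [Milne1999] J. S. Milne, Lefschetz motives and the Tate conjecture, Compositio Math. 117 (1999), Prop. 2.1, p. 54.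
-/

namespace Summit.HodgeConjecture.CorCM.Census.TwistGeneration

open Finset
open Summit.HodgeConjecture.CorCM.Prior.AllgGroup.RfwfAllgGroup
open Summit.HodgeConjecture.CorCM.Census.BlockParity
open Summit.HodgeConjecture.CorCM.Census.Coinvariant
open Summit.HodgeConjecture.CorCM.Census.CoinvariantTwist

noncomputable section

variable {G : Type*} [Group G] [Fintype G] [DecidableEq G] {c : G}
variable {B : Type} [AddGroup B] [Fintype B]
variable {n : ℕ} [NeZero n] (θ : G ≃ ZMod (2 * n) × B)
variable (hθ : ∀ P Q : G, θ (P * Q) = θ P + θ Q) (hθc : θ c = (((n : ℕ) : ZMod (2 * n)), 0))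
variable {b₁ b₂ : B} (h12 : b₁ ≠ b₂) (huniv : ∀ b : B, b = b₁ ∨ b = b₂)

/-! ## §1 The double corner of a transfer face lies in the upper class of `1` -/

/-- A flip at a point outside the type moves the distance to a centre by one, down iff the point lies in the centre. [folklore] -/
theorem ddist_oflipCM_cases (hc2 : c * c = 1) (T Ψ : CMF G c) {t : G} (ht : t ∉ Ψ.1) :
    (t ∈ T.1 → ddist T (oflipCM c hc2 t Ψ) + 1 = ddist T Ψ) ∧ (t ∉ T.1 → ddist T (oflipCM c hc2 t Ψ) = ddist T Ψ + 1) :=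
  ⟨fun h => ddist_oflipCM_of_mem_sdiff hc2 (mem_sdiff.mpr ⟨h, ht⟩), fun h => ddist_oflipCM_of_not_mem hc2 ht h⟩

include h12 huniv in
/-- **The double corner `Y_k = (catom 0 b₂)^{(θ⁻¹(k,b₁))}` (`2 ≤ k < n`) lies in `upCl 1`.** [folklore] -/
theorem corner_mem_upCl_one (hc2 : c * c = 1) (hn : 2 ≤ n) {k : ℕ} (hk2 : 2 ≤ k) (hkn : k < n) :
    oflipCM c hc2 (θ.symm ((k : ℕ), b₁)) (catom θ hθ hθc hc2 0 b₂) ∈ upCl θ hθ hθc 1 := by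
  have h2n : n < 2 * n := by omega
  have hB : Fintype.card B = 2 := card_eq_two_of_two h12 huniv
  -- the two flips from `cst 0`, written at points OUTSIDE the types
  set t₂ : G := θ.symm (((n : ℕ) : ZMod (2 * n)), b₂) with ht₂def
  set t₁ : G := θ.symm (((k + n : ℕ) : ZMod (2 * n)), b₁) with ht₁def
  set C : CMF G c := catom θ hθ hθc hc2 0 b₂ with hCdef
  have eC : C = oflipCM c hc2 t₂ (cst θ hθ hθc 0) := by
    rw [hCdef, catom, ← oflipCM_cmul c hc2 (θ.symm (0, b₂)), c_mul_symm θ hθ hθc, zero_add]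
  have eY : oflipCM c hc2 (θ.symm ((k : ℕ), b₁)) C = oflipCM c hc2 t₁ C := by
    rw [← oflipCM_cmul c hc2 (θ.symm ((k : ℕ), b₁)), c_mul_symm θ hθ hθc, ht₁def, Nat.cast_add]
  have ht₂ : t₂ ∉ (cst θ hθ hθc 0).1 := by rw [symm_mem_cst, sub_zero, val_n]; exact lt_irrefl n
  have ht₁ : t₁ ∉ C.1 := by
    rw [hCdef, catom, mem_oflipCM_iff' hc2, symm_mem_cst, symm_mem_orb_symm_iff θ hθ hθc, sub_zero,
      ZMod.val_cast_of_lt (by omega), not_not]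
    constructor
    · intro h; omega
    · intro h; exact absurd h.1 h12
  -- the distances of `Y` from every centre
  have key : ∀ a' : ZMod (2 * n), (ddist (cst θ hθ hθc a') (oflipCM c hc2 t₁ C) = 2 ↔
      (a'.val = 0 ∨ a'.val = 1 ∨ (a'.val = 2 * n - 1 ∧ k + 1 = n))) ∧ 2 ≤ ddist (cst θ hθ hθc a') (oflipCM c hc2 t₁ C) := by
    intro a'
    have hv := ZMod.val_lt a'
    -- the distance of `cst a'` from `cst 0`
    have hD1 : a'.val ≤ n → ddist (cst θ hθ hθc a') (cst θ hθ hθc 0) = a'.val * 2 := fun h => by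
      have e := ddist_cst_cst_of_val_le θ hθ hθc (a := 0) (a' := a') (by rw [sub_zero]; exact h)
      rwa [sub_zero, hB] at e
    have hD2 : n ≤ a'.val → ddist (cst θ hθ hθc a') (cst θ hθ hθc 0) = (2 * n - a'.val) * 2 := fun h => by
      have hne : a' ≠ 0 := fun h0 => by rw [h0, ZMod.val_zero] at h; omega
      have hneg : (0 - a').val = 2 * n - a'.val := by rw [zero_sub, ZMod.neg_val, if_neg hne]
      have e := ddist_cst_cst_of_val_le' θ hθ hθc hc2 (a := 0) (a' := a') (by rw [hneg]; omega)
      rwa [hneg, hB] at e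
    -- membership of the flip points in `cst a'`
    have hm₂ : t₂ ∈ (cst θ hθ hθc a').1 ↔ (1 ≤ a'.val ∧ a'.val ≤ n) := by
      rw [symm_mem_cst, val_sub_eq, val_n]; split_ifs with h <;> omega
    have hm₁ : t₁ ∈ (cst θ hθ hθc a').1 ↔ (k + 1 ≤ a'.val ∧ a'.val ≤ k + n) := by
      rw [symm_mem_cst, val_sub_eq, ZMod.val_cast_of_lt (by omega)]; split_ifs with h <;> omega
    obtain ⟨f₂a, f₂b⟩ := ddist_oflipCM_cases hc2 (cst θ hθ hθc a') (cst θ hθ hθc 0) ht₂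
    obtain ⟨f₁a, f₁b⟩ := ddist_oflipCM_cases hc2 (cst θ hθ hθc a') C ht₁
    rw [← eC] at f₂a f₂b
    rw [hm₂] at f₂a f₂b
    rw [hm₁] at f₁a f₁b
    by_cases c2 : 1 ≤ a'.val ∧ a'.val ≤ n <;> by_cases c1 : k + 1 ≤ a'.val ∧ a'.val ≤ k + n
    · have e2 := f₂a c2; have e1 := f₁a c1
      by_cases hle : a'.val ≤ n
      · have := hD1 hle; constructor <;> omega
      · have := hD2 (by omega); constructor <;> omega
    · have e2 := f₂a c2; have e1 := f₁b c1
      by_cases hle : a'.val ≤ n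
      · have := hD1 hle; constructor <;> omega
      · have := hD2 (by omega); constructor <;> omega
    · have e2 := f₂b c2; have e1 := f₁a c1
      by_cases hle : a'.val ≤ n
      · have := hD1 hle; constructor <;> omega
      · have := hD2 (by omega); constructor <;> omega
    · have e2 := f₂b c2; have e1 := f₁b c1
      by_cases hle : a'.val ≤ n
      · have := hD1 hle; constructor <;> omega
      · have := hD2 (by omega); constructor <;> omega
  -- the potential of `Y` is `2`
  have hpot : pot θ hθ hθc (oflipCM c hc2 t₁ C) = 2 := by
    apply le_antisymm
    · have h0 := ((key 0).1).mpr (Or.inl (ZMod.val_zero))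
      rw [← h0]; exact pot_le θ hθ hθc _ 0
    · obtain ⟨a₀, ha₀⟩ := exists_pot_eq θ hθ hθc (oflipCM c hc2 t₁ C)
      rw [ha₀]; exact (key a₀).2
  have h1val : (1 : ZMod (2 * n)).val = 1 := by
    rw [show (1 : ZMod (2 * n)) = ((1 : ℕ) : ZMod (2 * n)) by norm_cast, ZMod.val_cast_of_lt (by omega)]
  rw [eY]
  by_cases hk : k + 1 = n
  · refine ⟨3, by omega, by omega, fun a' => ?_⟩
    rw [hpot, (key a').1, val_sub_eq, h1val]
    have := ZMod.val_lt a'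
    split_ifs with h <;> omega
  · refine ⟨2, by omega, hn, fun a' => ?_⟩
    rw [hpot, (key a').1, val_sub_eq, h1val]
    have := ZMod.val_lt a'
    split_ifs with h <;> omega

omit [Fintype B] in
include h12 huniv in
/-- **The star form of the double corner about `cst 1`** (two columns): `θ_{cst 1}[Y_k] = [catom 0 b₂] + [cst 1^{(θ⁻¹(k,b₁))}] − [cst 1]`
(`1 ≤ k < n`; the lower atom of `cst 1` at `b₁` IS `catom 0 b₂`). [folklore] -/
theorem thetaG_cst_one_corner (hc2 : c * c = 1) {k : ℕ} (hk1 : 1 ≤ k) (hkn : k < n) :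
    thetaG c hc2 (cst θ hθ hθc 1) (typeSum G c (Finsupp.single (oflipCM c hc2 (θ.symm ((k : ℕ), b₁)) (catom θ hθ hθc hc2 0 b₂)) 1)) =
      Finsupp.single (catom θ hθ hθc hc2 0 b₂) 1 + Finsupp.single (oflipCM c hc2 (θ.symm ((k : ℕ), b₁)) (cst θ hθ hθc 1)) 1
        - Finsupp.single (cst θ hθ hθc 1) 1 := by
  have h2n : n < 2 * n := by have := NeZero.ne n; omega
  -- `catom 0 b₂` is `cst 1` lowered at `b₁`, i.e. flipped at `θ⁻¹(n, b₁) ∈ cst 1`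
  have hn1 : θ.symm (((n : ℕ) : ZMod (2 * n)), b₁) ∈ (cst θ hθ hθc 1).1 :=
    symm_natCast_mem_cst_one θ hθ hθc (Nat.one_le_iff_ne_zero.mpr (NeZero.ne n)) le_rfl b₁
  have eC : catom θ hθ hθc hc2 0 b₂ = oflipCM c hc2 (θ.symm (((n : ℕ) : ZMod (2 * n)), b₁)) (cst θ hθ hθc 1) := by
    rw [← zero_add (1 : ZMod (2 * n)), ← oflipCM_cst_succ_eq_catom θ hθ hθc h12 huniv hc2 0, ← oflipCM_cmul c hc2 (θ.symm (0, b₁)),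
      c_mul_symm θ hθ hθc, zero_add, zero_add]
  have h0 : thetaG c hc2 (cst θ hθ hθc 1) (typeSum G c (Finsupp.single (cst θ hθ hθc 1) 1)) = Finsupp.single (cst θ hθ hθc 1) 1 := by
    rw [thetaG_typeSum_single, sdiff_self, Finset.bot_eq_empty, sum_empty, zero_add]
  have step1 := thetaG_oflipCM_sub_of_mem hc2 (T := cst θ hθ hθc 1) (Φ := cst θ hθ hθc 1) hn1 hn1
  rw [← eC, h0] at step1
  -- then flipped at `θ⁻¹(k, b₁) ∈ cst 1 ∩ catom 0 b₂`
  have hk1' : θ.symm ((k : ℕ), b₁) ∈ (cst θ hθ hθc 1).1 := symm_natCast_mem_cst_one θ hθ hθc hk1 hkn.le b₁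
  have hkC : θ.symm ((k : ℕ), b₁) ∈ (catom θ hθ hθc hc2 0 b₂).1 := by
    rw [catom, mem_oflipCM_iff' hc2, symm_mem_orb_symm_iff θ hθ hθc]
    exact fun h => h12 (h.mp (symm_natCast_mem_cst_zero θ hθ hθc hkn b₁)).1
  have step2 := thetaG_oflipCM_sub_of_mem hc2 hk1' hkC
  rw [sub_eq_iff_eq_add] at step1 step2
  rw [step2, step1]
  abel

/-! ## §2 The transfer faces yield the transfers (two columns) -/

include h12 huniv in
/-- **THE TRANSFER FACE REDUCES TO THE TRANSFER (two columns).**  If `L` holds the star forms of the upper classes and the face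
`gface (cst 0) θ⁻¹(k, b₁) θ⁻¹(0, b₂)` (`2 ≤ k < n`), then `trans 0 k b₁ ∈ L`. [folklore] -/
theorem trans_zero_mem_two (hc2 : c * c = 1) (hn : 2 ≤ n) {k : ℕ} (hk2 : 2 ≤ k) (hkn : k < n) (L : Submodule ℤ (CMF G c →₀ ℤ))
    (hstar : ∀ (a : ZMod (2 * n)) (Φ : CMF G c), Φ ∈ upCl θ hθ hθc a →
      Finsupp.single Φ 1 - thetaG c hc2 (cst θ hθ hθc a) (typeSum G c (Finsupp.single Φ 1)) ∈ L)
    (hface : gface c hc2 (cst θ hθ hθc 0) (θ.symm ((k : ℕ), b₁)) (θ.symm (0, b₂)) ∈ L) :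
    trans θ hθ hθc hc2 0 ((k : ℕ) : ZMod (2 * n)) b₁ ∈ L := by
  have m := hstar 1 _ (corner_mem_upCl_one θ hθ hθc h12 huniv hc2 hn hk2 hkn)
  rw [thetaG_cst_one_corner θ hθ hθc h12 huniv hc2 (by omega) hkn] at m
  have e : trans θ hθ hθc hc2 0 ((k : ℕ) : ZMod (2 * n)) b₁ =
      (Finsupp.single (oflipCM c hc2 (θ.symm ((k : ℕ), b₁)) (catom θ hθ hθc hc2 0 b₂)) 1
        - (Finsupp.single (catom θ hθ hθc hc2 0 b₂) 1 + Finsupp.single (oflipCM c hc2 (θ.symm ((k : ℕ), b₁)) (cst θ hθ hθc 1)) 1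
            - Finsupp.single (cst θ hθ hθc 1) 1))
      - gface c hc2 (cst θ hθ hθc 0) (θ.symm ((k : ℕ), b₁)) (θ.symm (0, b₂)) := by
    rw [trans, gface, zero_add]
    change _ = _ - (Finsupp.single (cst θ hθ hθc 0) 1
      + Finsupp.single (oflipCM c hc2 (θ.symm ((k : ℕ), b₁)) (catom θ hθ hθc hc2 0 b₂)) 1
      - Finsupp.single (oflipCM c hc2 (θ.symm ((k : ℕ), b₁)) (cst θ hθ hθc 0)) 1 - Finsupp.single (catom θ hθ hθc hc2 0 b₂) 1)
    abel
  rw [e]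
  exact Submodule.sub_mem _ m hface

/-! ## §3 The count: `n` distinct residual blocks -/

include hθ hθc h12 huniv in
/-- **Atoms of `cst 0` at the rows `1, …, n − 1` are at distance `3` from `cst 1`** (two columns). [folklore] -/
theorem ddist_cst_one_oflipCM_cst_zero (hc2 : c * c = 1) {i : ZMod (2 * n)} (hi1 : 1 ≤ i.val) (hi : i.val < n) (b : B) :
    ddist (cst θ hθ hθc 1) (oflipCM c hc2 (θ.symm (i, b)) (cst θ hθ hθc 0)) = 3 := by
  have h2n : n < 2 * n := by omega
  have hB : Fintype.card B = 2 := card_eq_two_of_two h12 huniv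
  have h1val : (1 : ZMod (2 * n)).val = 1 := by
    rw [show (1 : ZMod (2 * n)) = ((1 : ℕ) : ZMod (2 * n)) by norm_cast, ZMod.val_cast_of_lt (by omega)]
  rw [← oflipCM_cmul c hc2, c_mul_symm θ hθ hθc]
  have ht : θ.symm (i + n, b) ∉ (cst θ hθ hθc 0).1 := by rw [symm_mem_cst, sub_zero, val_add_n, if_pos hi]; omega
  have ht1 : θ.symm (i + n, b) ∉ (cst θ hθ hθc 1).1 := by
    rw [symm_mem_cst, val_sub_eq, h1val, val_add_n, if_pos hi]; split_ifs <;> omega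
  rw [ddist_oflipCM_of_not_mem hc2 ht ht1]
  have h := ddist_cst_cst_of_val_le θ hθ hθc (a := (0 : ZMod (2 * n))) (a' := 1) (by rw [sub_zero, h1val]; omega)
  rw [sub_zero, h1val, hB] at h
  rw [h]

include h12 huniv in
/-- **Distinct rows give distinct atom blocks** (two columns, rows `1, …, n − 1`). [folklore] -/
theorem eq_of_blk_oflipCM_eq_two (hc2 : c * c = 1) (hn : 2 ≤ n) {i i' : ZMod (2 * n)} (hi1 : 1 ≤ i.val) (hi : i.val < n)
    (hi1' : 1 ≤ i'.val) (hi' : i'.val < n) {b b' : B}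
    (h : blk c (oflipCM c hc2 (θ.symm (i, b)) (cst θ hθ hθc 0)) = blk c (oflipCM c hc2 (θ.symm (i', b')) (cst θ hθ hθc 0))) :
    i = i' := by
  have h2n : n < 2 * n := by omega
  have hB : Fintype.card B = 2 := card_eq_two_of_two h12 huniv
  have hti : θ.symm (i, b) ∈ (cst θ hθ hθc 0).1 := by rw [symm_mem_cst, sub_zero]; exact hi
  have hti' : θ.symm (i', b') ∈ (cst θ hθ hθc 0).1 := by rw [symm_mem_cst, sub_zero]; exact hi'
  obtain ⟨Q, hQ⟩ := exists_rt_eq_of_blk_eq c h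
  set q : ZMod (2 * n) := (θ Q).1 with hq
  -- distances `1` from the centres `cst q` (for `Ψ_i`) and `cst (−q)` (for `Ψ_{i'}`)
  have hd0 : ddist (cst θ hθ hθc 0) (oflipCM c hc2 (θ.symm (i, b)) (cst θ hθ hθc 0)) = 1 := by
    rw [ddist, sdiff_oflipCM_cst θ hθ hθc hc2 hti, card_singleton]
  have hd0' : ddist (cst θ hθ hθc 0) (oflipCM c hc2 (θ.symm (i', b')) (cst θ hθ hθc 0)) = 1 := by
    rw [ddist, sdiff_oflipCM_cst θ hθ hθc hc2 hti', card_singleton]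
  have hdq : ddist (cst θ hθ hθc q) (oflipCM c hc2 (θ.symm (i, b)) (cst θ hθ hθc 0)) = 1 := by
    have e := ddist_cst_rt θ hθ hθc Q (oflipCM c hc2 (θ.symm (i, b)) (cst θ hθ hθc 0)) 0
    rw [hQ, zero_add, hd0'] at e; exact e.symm
  have hdq' : ddist (cst θ hθ hθc (-q)) (oflipCM c hc2 (θ.symm (i', b')) (cst θ hθ hθc 0)) = 1 := by
    have e := ddist_cst_rt θ hθ hθc Q (oflipCM c hc2 (θ.symm (i, b)) (cst θ hθ hθc 0)) (-q)
    rw [hQ, neg_add_cancel, hd0] at e; exact e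
  -- the centre `cst q` is within `2` of `cst 0`, so `q ∈ {0, 1, −1}`; `±1` contradict the distance `3` from `cst 1`
  have htri := card_sdiff_le_ddist_add hc2 (cst θ hθ hθc 0) (cst θ hθ hθc q) (oflipCM c hc2 (θ.symm (i, b)) (cst θ hθ hθc 0))
  rw [hdq, hd0] at htri
  have h3 := ddist_cst_one_oflipCM_cst_zero θ hθ hθc h12 huniv hc2 hi1 hi b
  have h3' := ddist_cst_one_oflipCM_cst_zero θ hθ hθc h12 huniv hc2 hi1' hi' b'
  have hq0 : q = 0 := by
    by_contra hne
    have hqv := ZMod.val_lt q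
    by_cases hle : q.val ≤ n
    · have e := ddist_cst_cst_of_val_le θ hθ hθc (a := (0 : ZMod (2 * n))) (a' := q) (by rw [sub_zero]; exact hle)
      rw [sub_zero, hB] at e
      change ddist (cst θ hθ hθc q) (cst θ hθ hθc 0) = q.val * 2 at e
      rw [ddist] at e
      have hq1 : q.val = 1 := by
        have : q.val ≠ 0 := fun h0 => hne ((ZMod.val_eq_zero q).mp h0)
        omega
      have : q = 1 := ZMod.val_injective _ (by
        rw [hq1, show (1 : ZMod (2 * n)) = ((1 : ℕ) : ZMod (2 * n)) by norm_cast, ZMod.val_cast_of_lt (by omega)])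
      rw [this] at hdq
      rw [hdq] at h3; exact absurd h3 (by norm_num)
    · have hneg : (0 - q).val = 2 * n - q.val := by rw [zero_sub, ZMod.neg_val, if_neg hne]
      have e := ddist_cst_cst_of_val_le' θ hθ hθc hc2 (a := (0 : ZMod (2 * n))) (a' := q) (by rw [hneg]; omega)
      rw [hneg, hB] at e
      change ddist (cst θ hθ hθc q) (cst θ hθ hθc 0) = (2 * n - q.val) * 2 at e
      rw [ddist] at e
      have hq1 : q.val = 2 * n - 1 := by omega
      have h1val : (1 : ZMod (2 * n)).val = 1 := by
        rw [show (1 : ZMod (2 * n)) = ((1 : ℕ) : ZMod (2 * n)) by norm_cast, ZMod.val_cast_of_lt (by omega)]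
      have h1ne : (1 : ZMod (2 * n)) ≠ 0 := fun h0 => by
        have h0' := congrArg ZMod.val h0
        rw [h1val, ZMod.val_zero] at h0'
        exact one_ne_zero h0'
      have : q = -1 := ZMod.val_injective _ (by rw [hq1, ZMod.neg_val, if_neg h1ne, h1val])
      rw [this, neg_neg] at hdq'
      rw [hdq'] at h3'; exact absurd h3' (by norm_num)
  -- same centre: the deviation places coincide
  rw [rt_oflipCM, rt_cst, ← hq, hq0, sub_zero] at hQ
  have hdev := sdiff_oflipCM_cst θ hθ hθc hc2 hti'
  have hmem : θ.symm (i, b) * Q⁻¹ ∈ (cst θ hθ hθc 0).1 := by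
    rw [mem_cst, hθ, map_inv_eq θ hθ, Equiv.apply_symm_apply, Prod.fst_add, Prod.fst_neg, ← hq, hq0, neg_zero, add_zero, sub_zero]
    exact hi
  rw [← hQ, sdiff_oflipCM_cst θ hθ hθc hc2 hmem] at hdev
  have heq : θ.symm (i, b) * Q⁻¹ = θ.symm (i', b') := singleton_injective hdev
  have h2 := congrArg (fun P => (θ P).1) heq
  simp only [hθ, map_inv_eq θ hθ, Equiv.apply_symm_apply, Prod.fst_add, Prod.fst_neg] at h2
  rw [← hq, hq0, neg_zero, add_zero] at h2
  exact h2

include h12 huniv in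
/-- **The count (two columns)**: the blocks of potential `≥ 2` number at most `β − n`. [folklore] -/
theorem card_filter_add_le_card_block_two (hc2 : c * c = 1) (hn : 2 ≤ n) :
    (univ.filter fun Bk : Block c => 2 ≤ pot θ hθ hθc Bk.out).card + n ≤ Fintype.card (Block c) := by
  classical
  have h2n : n < 2 * n := by omega
  set f : ℕ → Block c := fun i => blk c (oflipCM c hc2 (θ.symm ((i : ℕ), b₁)) (cst θ hθ hθc 0)) with hf
  set RB : Finset (Block c) := insert (blk c (cst θ hθ hθc 0)) ((Ico 1 n).image f) with hRB
  have hpot_out : ∀ Ψ : CMF G c, pot θ hθ hθc (blk c Ψ).out = pot θ hθ hθc Ψ := by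
    intro Ψ
    obtain ⟨Q, hQ⟩ := exists_rt_eq_of_blk_eq c (Quotient.out_eq (blk c Ψ) : blk c (blk c Ψ).out = blk c Ψ)
    rw [← pot_rt θ hθ hθc Q, hQ]
  have hmem0 : ∀ i : ℕ, i < n → θ.symm ((i : ℕ), b₁) ∈ (cst θ hθ hθc 0).1 := fun i hi =>
    symm_natCast_mem_cst_zero θ hθ hθc hi b₁
  have hinj : Set.InjOn f ↑(Ico 1 n) := by
    intro i hi i' hi' h
    have hi := mem_Ico.mp (mem_coe.mp hi)
    have hi' := mem_Ico.mp (mem_coe.mp hi')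
    have h1 := eq_of_blk_oflipCM_eq_two θ hθ hθc h12 huniv hc2 hn (i := ((i : ℕ) : ZMod (2 * n))) (i' := ((i' : ℕ) : ZMod (2 * n)))
      (by rw [ZMod.val_cast_of_lt (by omega)]; exact hi.1) (by rw [ZMod.val_cast_of_lt (by omega)]; exact hi.2)
      (by rw [ZMod.val_cast_of_lt (by omega)]; exact hi'.1) (by rw [ZMod.val_cast_of_lt (by omega)]; exact hi'.2) h
    have h2 := congrArg ZMod.val h1
    rwa [ZMod.val_cast_of_lt (by omega), ZMod.val_cast_of_lt (by omega)] at h2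
  have hnot : blk c (cst θ hθ hθc 0) ∉ (Ico 1 n).image f := by
    intro h
    obtain ⟨i, hi, hfi⟩ := mem_image.mp h
    obtain ⟨Q, hQ⟩ := exists_rt_eq_of_blk_eq c hfi
    have h1 := pot_rt θ hθ hθc Q (oflipCM c hc2 (θ.symm ((i : ℕ), b₁)) (cst θ hθ hθc 0))
    rw [hQ, pot_cst, pot_oflipCM_cst θ hθ hθc hc2 (by rw [card_eq_two_of_two h12 huniv]) (hmem0 i (mem_Ico.mp hi).2)] at h1
    exact one_ne_zero h1.symm
  have hcard : RB.card = n := by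
    rw [hRB, card_insert_of_notMem hnot, card_image_of_injOn hinj, Nat.card_Ico]; omega
  have hres : ∀ Bk ∈ RB, pot θ hθ hθc Bk.out ≤ 1 := by
    intro Bk hBk
    rcases mem_insert.mp hBk with rfl | h
    · rw [hpot_out, pot_cst]; exact zero_le_one
    · obtain ⟨i, hi, rfl⟩ := mem_image.mp h
      change pot θ hθ hθc (blk c _).out ≤ 1
      rw [hpot_out, pot_oflipCM_cst θ hθ hθc hc2 (by rw [card_eq_two_of_two h12 huniv]) (hmem0 i (mem_Ico.mp hi).2)]
  have hsub : (univ.filter fun Bk : Block c => 2 ≤ pot θ hθ hθc Bk.out) ⊆ univ \ RB := by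
    intro Bk hBk
    rw [mem_sdiff]
    exact ⟨mem_univ _, fun h => by have := (mem_filter.mp hBk).2; have := hres Bk h; omega⟩
  have h := card_le_card hsub
  rw [card_sdiff_of_subset (subset_univ _), card_univ, hcard] at h
  have : n ≤ Fintype.card (Block c) := by rw [← hcard, ← card_univ]; exact card_le_univ _
  omega

end

end Summit.HodgeConjecture.CorCM.Census.TwistGeneration
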